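import Summits.ResolutionOfSingularities.ResolutionOfSingularities.Theorems.SharpStrataDefs
import Summits.ResolutionOfSingularities.ResolutionOfSingularities.Theorems.SharpStrataResSepExcIsolatedCore
import Summits.ResolutionOfSingularities.ResolutionOfSingularities.Theorems.SharpStrataResSepExcDimension
import Summits.ResolutionOfSingularities.ResolutionOfSingularities.Theorems.SharpStrataResSepExcComponents
import HarnessLib

/-!
# Crux `ResSepExc` (stmt-ResolutionOfSingularities-16829) — line `birth`, skeleton v4 (lead c3)

## What changed from v3 (lead c2, sha ee1375c6ccb6) — lead c3, 2026-08-17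

* Stubs and composition: UNCHANGED (the two stub headers are byte-identical to the registered
  ones; `ResSepExc_proof` closes the crux BY NAME modulo exactly them). Both stubs remain
  stub-blocked: `stub_isolateSingularities` ⟸ stmt-18020 (W), `stub_isolatedResolution` ⟺
  stmt-18021 (K) over perfect fields; 18020 / 18021 / 18022 open, unclaimed, unchanged (13:50Z).
* New, imported from the landed `Theorems/SharpStrataResSepExcComponents.lean` (p164590): the
  COMPONENT calibration. Finitely many non-regular points descends to each irreducible component
  with its reduced structure (`finite_nonRegular_subscheme_of_mem_irreducibleComponents`: a regular
  point lies on one component, off the others the component's closed immersion is an isomorphism),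
  so the crux closes stmt-18021 restricted to perfect fields IN ITS FILED BINDER SHAPE (reduced `X`,
  not only integral: `isolatedResolution_perfectField_of_resSepExc`), and modulo W|perfect the crux
  is EQUIVALENT to K|perfect (`resSepExc_iff_isolatedResolution_perfectField`). Restated at the end
  of this file (`isolatedResolution_perfectField_of_ResSepExc`,
  `ResSepExc_iff_isolatedResolution_perfectField_of_W`). Net: the line is parked on stmt-18021, which
  (over perfect fields) is now literally a consequence of the crux and, given stmt-18020 over perfect
  fields, equivalent to it.

## What changed from v2 (lead c1, sha 01dd90b2f4ab) — lead c2, 2026-08-17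

* Stubs and composition: UNCHANGED (the two stub headers are byte-identical to the registered
  ones; `ResSepExc_proof` closes the crux BY NAME modulo exactly them).
* New, imported from the landed `Theorems/SharpStrataResSepExcDimension.lean` (p154439): the
  DIMENSION calibration. Along a proper birational model `dim X' = dim X`
  (`topologicalKrullDim_model_eq`), so the cut is exact in every dimension
  (`resSepExc_dimLE_iff_stubs_dimLE`); modulo the named fact `CossartPiltant2019` both stub
  slices and the crux slice hold for `dim X ≤ 3`, hence the crux and EACH stub is equivalent to
  its `¬ dim X ≤ 3` slice (`resSepExc_iff_dimGe4`, `isolatedModelsInChar_iff_dimGe4`,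
  `resolutionOfIsolatedInChar_iff_dimGe4`); and the first open case, dimension `4`, is pinned on
  named statements: `ResSepExc|dim ≤ 4 ⟸ IsolatedCore.FiniteSingularModelsDimFour (stmt-18022) ∧
  (K for integral fourfolds over perfect fields)` (`resSepExc_dimLE_four_of_finiteSingularModelsDimFour`),
  `ResSepExc|dim ≤ d ⟹ (K|dim ≤ d, integral, perfect)` (`resolutionOfIsolated_dimLE_of_resSepExc_dimLE`).
  Restated at the end of this file through the skeleton's own stub shapes
  (`stubs_dimLE_three`, `ResSepExc_dimLE_four_of_isolatedCoreDimFour`).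

# (v2 header, lead c1)

Route `ResolutionOfSingularities/SharpStrata`, crux #3 (rank 3, difficulty: open-problem):
`ResSepExc` = "for every prime `p` and every PERFECT field `k` of characteristic `p`, every
integral separated `k`-scheme of finite type that is SEPARABLY EXCEPTIONAL (every point is
regular, or closed, or carries a prime divisor with separably generated residue field — the
`let SepExc` of the route file, Benito–Piltant–Reguera 2022 Prop. 4.3 / Thm. 4.4) has a
resolution of singularities (`Scheme.HasResolution`)".

## What changed from v1 (`Lines/birth.lean`, planner skeleton, sha d73df94b2a1b)

* Vocabulary from the tree: `SepExc`, `IsolatedSing`, `IsolatedModelsInChar`,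
  `ResolutionOfIsolatedInChar`, `resSepExc_of` are the landed declarations of
  `Theorems/SharpStrataDefs.lean` (p149622) — no local copies; the two stub headers are
  byte-identical to the registered ones.
* The two reductions found by lead c0 are now IN the skeleton, proved from the landed bridge
  file `Theorems/SharpStrataResSepExcIsolatedCore.lean` (p149609):
  `stub_isolateSingularities_of_finiteSingularModels` — crux `W` of route `IsolatedCore`
  (stmt-18020) gives stub 1 with `SepExc X` and `PerfectField k` idle;
  `stub_isolatedResolution_of_isolatedResolution` — crux `K` of route `IsolatedCore`
  (stmt-18021) gives stub 2.
* Exactness of the cut (landing as `Theorems/SharpStrataResSepExcCalibration.lean`,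
  `resSepExc_iff_stubs`): `ResSepExc ↔ (∀ p, IsolatedModelsInChar p) ∧
  (∀ p, ResolutionOfIsolatedInChar p)` — BOTH stubs are necessary conditions of the crux, so no
  reshaping of this cut makes either stub easier than the corresponding case of the crux; in
  particular stub 2 is resolution of isolated singularities over perfect fields in every
  dimension (open from dimension 4: already `z^p + g(x,y,u,v)` with an isolated singular point).

## Status of the stubs (lead c1, 2026-08-17)

* `stub_isolateSingularities` — OPEN; ⟸ stmt-18020 (`IsolatedCore.FiniteSingularModels`, open
  from dimension 4, first open case filed as stmt-18022); the route's own lever (bluntness ⇒ a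
  generically smooth exceptional prime divisor over each positive-dimensional singular stratum,
  BPR Lemma 4.2) addresses the spreading of a resolution of the slice `Spec 𝒪_{X,ζ}` along the
  stratum, which needs no bluntness, and not the patching/termination over the special points,
  which is the printed-open global half of barrier `DimensionFourFrontier`.
* `stub_isolatedResolution` — OPEN; ⟺ the integral perfect-field case of stmt-18021
  (`IsolatedCore.IsolatedResolution`): `K ⇒ stub` here, `ResSepExc ⇒ K|(integral, perfect)` is
  `hasResolution_of_resSepExc_of_finite_nonRegular` (landed). Necessary for the crux.

So the crux is parked on stmt-18021 (necessary) and stmt-18020 (sufficient together with it);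
`ResSepExc_proof` below closes the crux BY NAME modulo exactly the two registered stubs.

## Status of the stubs (lead c2, 2026-08-17T10:40Z; again lead c3, 13:50Z): unchanged — both OPEN and stub-blocked
(18020 / 18021 open, unclaimed, no stubs of their own); open exactly from dimension `4` (v3 section
at the end of the file); dimension-4 entry points: stmt-18022 (for stub 1) and "K for integral
fourfolds over perfect fields" (= stub 2 at `dim X ≤ 4`, necessary for the crux slice).
-/

noncomputable section

-- single-problem summit: the doubled namespace component `ResolutionOfSingularities` is forced
set_option linter.dupNamespace false

open CategoryTheory AlgebraicGeometry Literature.AlgebraicGeometry.Resolution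
open Summit.ResolutionOfSingularities.ResolutionOfSingularities.Theses
open Summit.ResolutionOfSingularities.ResolutionOfSingularities.Theses.SharpStrata
open Summit.ResolutionOfSingularities.ResolutionOfSingularities.Theorems.SharpStrata

namespace Summit.ResolutionOfSingularities.ResolutionOfSingularities.Cruxes.ResSepExc.Lines.Birth

/-! ## The stubs (registered on stmt-16829; headers verbatim) -/

/-- **STUB 1 (stratum-generic phase; open from dimension 4; ⟸ stmt-18020).** Separably
exceptional varieties over a perfect field admit proper birational integral models with isolated
singularities. [cite: BenitoPiltantReguera2022, Lemma 4.2, Prop. 4.3, Question 6.6;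
CossartPiltant2019, Thm. 1.1 and §1] -/
theorem stub_isolateSingularities (p : ℕ) (hp : p.Prime) (k : Type) [Field k] [CharP k p]
    [PerfectField k] (X : Scheme.{0}) [IsIntegral X] (f : X ⟶ Spec (.of k)) (hs : IsSeparated f)
    (hl : LocallyOfFiniteType f) (hq : QuasiCompact f) (hX : SepExc X) :
    ∃ (X' : Scheme.{0}) (_ : IsIntegral X') (π : X' ⟶ X),
      IsProper π ∧ IsBirational π ∧ IsolatedSing X' := by
  sorry

/-- **STUB 2 (closed-point phase; open from dimension 4; ⟺ stmt-18021 on integral varieties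
over perfect fields; NECESSARY for the crux).** Integral separated varieties of finite type over
a perfect field of characteristic `p` with isolated singularities are resolvable.
[cite: Kollar2007, Ch. 3; HauserPerlega2019; CossartJannsenSaito2020] -/
theorem stub_isolatedResolution (p : ℕ) (hp : p.Prime) (k : Type) [Field k] [CharP k p]
    [PerfectField k] (X : Scheme.{0}) [IsIntegral X] (f : X ⟶ Spec (.of k)) (hs : IsSeparated f)
    (hl : LocallyOfFiniteType f) (hq : QuasiCompact f) (hX : IsolatedSing X) :
    Scheme.HasResolution X := by
  sorry

/-! ## The composition (kernel-checked; its own term is sorry-free) -/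

/-- **The crux `ResSepExc`, assembled from the two registered stubs** through the landed
composition `Theorems.SharpStrata.resSepExc_of` (take the isolated-singularity model of stub 1,
resolve it by stub 2, transport the resolution down the proper birational map). The only
`sorry`s in its closure are the two stubs. -/
theorem ResSepExc_proof : ResSepExc :=
  resSepExc_of (fun p hp => stub_isolateSingularities p hp) (fun p hp => stub_isolatedResolution p hp)

/-! ## Where each stub comes from (proved): the cruxes of route `IsolatedCore` -/

/-- **Stub 1 from `W` (stmt-18020)**, the hypotheses `SepExc X` and `PerfectField k` idle:
`IsolatedCore.FiniteSingularModels` hands every integral separated finite-type scheme over a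
field of characteristic `p` a proper birational integral model all of whose points are regular
or closed (`exists_model_regular_or_isClosed_of_finiteSingularModels`, landed p149609).
[folklore] -/
theorem stub_isolateSingularities_of_finiteSingularModels
    (hW : IsolatedCore.FiniteSingularModels) (p : ℕ) (hp : p.Prime) (k : Type) [Field k]
    [CharP k p] [PerfectField k] (X : Scheme.{0}) [IsIntegral X] (f : X ⟶ Spec (.of k))
    (hs : IsSeparated f) (hl : LocallyOfFiniteType f) (hq : QuasiCompact f) (_hX : SepExc X) :
    ∃ (X' : Scheme.{0}) (_ : IsIntegral X') (π : X' ⟶ X),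
      IsProper π ∧ IsBirational π ∧ IsolatedSing X' := by
  haveI := hs; haveI := hl; haveI := hq
  exact exists_model_regular_or_isClosed_of_finiteSingularModels hW hp k X f

/-- **Stub 2 from `K` (stmt-18021)**: `IsolatedCore.IsolatedResolution` resolves every integral
separated finite-type scheme over a field of characteristic `p` all of whose points are regular
or closed (`hasResolution_of_isolatedResolution_of_regular_or_isClosed`, landed p149609;
perfectness unused). [folklore] -/
theorem stub_isolatedResolution_of_isolatedResolution
    (hK : IsolatedCore.IsolatedResolution) (p : ℕ) (hp : p.Prime) (k : Type) [Field k]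
    [CharP k p] [PerfectField k] (X : Scheme.{0}) [IsIntegral X] (f : X ⟶ Spec (.of k))
    (hs : IsSeparated f) (hl : LocallyOfFiniteType f) (hq : QuasiCompact f)
    (hX : IsolatedSing X) : Scheme.HasResolution X := by
  haveI := hs; haveI := hl; haveI := hq
  exact hasResolution_of_isolatedResolution_of_regular_or_isClosed hK hp k X f hX

/-- **The whole line from `W ∧ K`** (= `resSepExc_of_finiteSingularModels_of_isolatedResolution`,
landed p149609), restated through this skeleton's composition: if both cruxes of route
`IsolatedCore` land, `ResSepExc_proof` closes by the two reductions above. [folklore] -/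
theorem ResSepExc_of_isolatedCore (hW : IsolatedCore.FiniteSingularModels)
    (hK : IsolatedCore.IsolatedResolution) : ResSepExc :=
  resSepExc_of (fun p hp => stub_isolateSingularities_of_finiteSingularModels hW p hp)
    (fun p hp => stub_isolatedResolution_of_isolatedResolution hK p hp)

/-- **Stub 2 is necessary** (the crux applied to a variety with isolated singularities, which is
separably exceptional vacuously: `IsolatedSing.sepExc`). [folklore] -/
theorem stub_isolatedResolution_of_resSepExc (h : ResSepExc) (p : ℕ) (hp : p.Prime) (k : Type)
    [Field k] [CharP k p] [PerfectField k] (X : Scheme.{0}) [IsIntegral X]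
    (f : X ⟶ Spec (.of k)) (hs : IsSeparated f) (hl : LocallyOfFiniteType f)
    (hq : QuasiCompact f) (hX : IsolatedSing X) : Scheme.HasResolution X :=
  resolutionOfIsolatedInChar_of_resSepExc h hp k X f hs hl hq hX

/-! ## Where the line is open: dimension `≥ 4` only (proved, v3; from the landed dimension file) -/

/-- **Both stubs hold in dimension `≤ 3`** modulo the named fact `CossartPiltant2019` (their
hypotheses `SepExc X` / `IsolatedSing X` and `PerfectField k` idle): the stub slices
`isolatedModels_dimLE_three` and `resolutionOfIsolated_dimLE_three` of
`Theorems/SharpStrataResSepExcDimension.lean` (p154439), in the skeleton's binder shape. So each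
`sorry` above is a statement about `X` with `¬ dim X ≤ 3` (`isolatedModelsInChar_iff_dimGe4`,
`resolutionOfIsolatedInChar_iff_dimGe4`). [cite: CossartPiltant2019, Thm. 1.1] -/
theorem stubs_dimLE_three (h : CossartPiltant2019.{0}) (p : ℕ) (k : Type) [Field k] [CharP k p]
    [PerfectField k] (X : Scheme.{0}) [IsIntegral X] (f : X ⟶ Spec (.of k)) (hs : IsSeparated f)
    (hl : LocallyOfFiniteType f) (hq : QuasiCompact f) (hd : topologicalKrullDim X ≤ 3) :
    (∃ (X' : Scheme.{0}) (_ : IsIntegral X') (π : X' ⟶ X),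
      IsProper π ∧ IsBirational π ∧ IsolatedSing X') ∧ Scheme.HasResolution X := by
  haveI := hs; haveI := hl; haveI := hq
  exact ⟨isolatedModels_dimLE_three h (p := p) k X f hd,
    resolutionOfIsolated_dimLE_three h (p := p) k X f hd⟩

/-- **The first open case of the line, dimension `4`, from route `IsolatedCore`'s dimension-4
support item**: if `IsolatedCore.FiniteSingularModelsDimFour` (stmt-18022) holds and stub 2 holds
for `X` of dimension `≤ 4`, then the crux holds for every separably exceptional `X` of dimension
`≤ 4` (`resSepExc_dimLE_four_of_finiteSingularModelsDimFour`, p154439: the model of a fourfold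
is a fourfold, `topologicalKrullDim_model_eq`). [folklore] -/
theorem ResSepExc_dimLE_four_of_isolatedCoreDimFour (hW : IsolatedCore.FiniteSingularModelsDimFour)
    (p : ℕ) (hp : p.Prime)
    (hK : ∀ (k : Type) [Field k] [CharP k p] [PerfectField k] (X : Scheme.{0}) [IsIntegral X]
      (f : X ⟶ Spec (.of k)), IsSeparated f → LocallyOfFiniteType f → QuasiCompact f →
      topologicalKrullDim X ≤ 4 → IsolatedSing X → Scheme.HasResolution X)
    (k : Type) [Field k] [CharP k p] [PerfectField k] (X : Scheme.{0}) [IsIntegral X]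
    (f : X ⟶ Spec (.of k)) (hs : IsSeparated f) (hl : LocallyOfFiniteType f) (hq : QuasiCompact f)
    (hd : topologicalKrullDim X ≤ 4) (hX : SepExc X) : Scheme.HasResolution X := by
  haveI := hs; haveI := hl; haveI := hq
  exact resSepExc_dimLE_four_of_finiteSingularModelsDimFour hW hp hK k X f hd hX

/-! ## v4 (lead c3): the crux closes `K|perfect` AS FILED; modulo `W|perfect` the crux IS `K|perfect` -/

/-- **The item behind stub 2, in the filed binder shape of stmt-18021 restricted to perfect
fields (REDUCED schemes with finitely many non-regular points), follows from the crux** — through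
this skeleton's `ResSepExc_proof` once the stubs close, here from the crux as a hypothesis
(`isolatedResolution_perfectField_of_resSepExc`, p164590: resolve each irreducible component by
the integral case and glue). [folklore] -/
theorem isolatedResolution_perfectField_of_ResSepExc (h : ResSepExc) :
    ∀ p : ℕ, p.Prime → ∀ (k : Type) [Field k] [CharP k p] [PerfectField k] (X : Scheme.{0})
      (f : X ⟶ Spec (.of k)), IsSeparated f → LocallyOfFiniteType f → QuasiCompact f →
      IsReduced X → {x : X | ¬ IsRegularLocalRing (X.presheaf.stalk x)}.Finite →
      Scheme.HasResolution X :=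
  isolatedResolution_perfectField_of_resSepExc h

/-- **Modulo `W` (stmt-18020) the crux is exactly `K` over perfect fields** (stmt-18021 with
`[PerfectField k]` inserted): `resSepExc_iff_isolatedResolution_perfectField_of_finiteSingularModels`
(p164590). So no line for this crux can be cheaper than K|perfect, and K|perfect ∧ W|perfect
suffices. [folklore] -/
theorem ResSepExc_iff_isolatedResolution_perfectField_of_W (hW : IsolatedCore.FiniteSingularModels) :
    ResSepExc ↔
      ∀ p : ℕ, p.Prime → ∀ (k : Type) [Field k] [CharP k p] [PerfectField k] (X : Scheme.{0})
        (f : X ⟶ Spec (.of k)), IsSeparated f → LocallyOfFiniteType f → QuasiCompact f →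
        IsReduced X → {x : X | ¬ IsRegularLocalRing (X.presheaf.stalk x)}.Finite →
        Scheme.HasResolution X :=
  resSepExc_iff_isolatedResolution_perfectField_of_finiteSingularModels hW

end Summit.ResolutionOfSingularities.ResolutionOfSingularities.Cruxes.ResSepExc.Lines.Birth

end
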